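import Summits.CriticalPhenomena.PercolationContinuityZ3.Theorems.SahiMasterFamilyThreePartitionTypedSliceKernel
import Summits.CriticalPhenomena.PercolationContinuityZ3.Theorems.PercNearOneGluingNoHeavyLowerTailThreePartitionVOrderNested
import HarnessLib

/-!
# THEOREM 1N: the ONE-NESTED SLICE STEP for twisted three-partition positivity
# (unit `prim-master-conj`, gen 34; `--supports stmt-CriticalPhenomena-4575`)

Memo `run/shared/lean/prim/prim-l12/prim-master-conj/POINTWISE.md` §34.1 / §35, `run/shared/lean/prim/prim-l12/FROM-prim-master-conj-g33-ONE-NESTED-STEP.md` §1.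
Let `𝒰, 𝒱, 𝒲 ⊆ 𝒫(ι)` be up-sets, `e ∈ ι`, `τ ⊆ ι` a twist, and suppose the CONTRACTION SECTIONS at `e` of `𝒰` and `𝒱` are
nested: `U¹_e ⊆ V¹_e`, i.e. `T ∪ e ∈ 𝒰 → T ∪ e ∈ 𝒱` for all `T`.  Then (`threePartNT` of `…ThreePartitionADTwisted`):
* **(a)** `e ∈ τ`:  `threePartNT τ 𝒰 𝒱 𝒲 ≥ 0` outright (`threePartNT_nonneg_of_oneNested_mem`);
* **(b)** `e ∉ τ`:  `threePartNT τ 𝒰⁰ 𝒱⁰ 𝒲⁰ ≤ 3 · threePartNT τ 𝒰 𝒱 𝒲` for the `e`-free lifts `𝒳⁰ = {T | T ∖ e ∈ 𝒳}` of the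
  deletion sections (`threePartNT_deletion_le_three_mul_of_oneNested`);
hence the ONE-NESTED DELETION STEP `0 ≤ N_τ(𝒰⁰,𝒱⁰,𝒲⁰) → 0 ≤ N_τ(𝒰,𝒱,𝒲)` (`threePartNT_nonneg_of_oneNested`, with the slot
variants `…13`, `…21`).  This strictly contains the tree's nested-pair case (`threePartNT_nonneg_of_nested`, `𝒱 ⊆ 𝒲` globally),
the co-cone / saturating-coordinate case `{e} ∈ 𝒰`, and is the "mixed" coordinate type of the one-coordinate method.
PROOF = the type-space certificates of gen 33 (POINTWISE §34.1), now kernel-checked: by the slicing theorem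
(`…TypedSliceKernel`) `N_τ = tsumP κ_β`; certificate (a) writes `κ₂ −` (3 untyped + 11 typed Kleitman atoms) and certificate
(b) writes `κ₁ −` (deletion minor + 2 untyped + 10 typed Kleitman atoms), all multipliers `1`, as residuals whose six-fold
symmetrisations are `≥ 0` on every sorted triple of class types (`check_residA`, `check_residB`: `decide +kernel` over the
`1 771` sorted triples of the 21 class types); every atom has a nonnegative pinned sum (`tsumP_atomKL_nonneg`), and the class
condition holds for realised types under `U¹_e ⊆ V¹_e` (`clsN_typ`).  No `sorry`, standard axioms, nothing conditional.
HONEST LABEL: a deletion STEP for a class of coordinates, not three-partition positivity; the recursive class it generates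
(POINTWISE §34 (V4)) is a reduction, not a proof of the crux. [this work]
-/

noncomputable section

open Finset
open scoped symmDiff Classical

namespace Summit.CriticalPhenomena.PercolationContinuityZ3.Theorems.ThreePartition

namespace TypedSlice

variable {ι : Type*}

/-! ## THEOREM 1N: the one-nested slice step -/

section OneNested

/-- The 14 atoms of certificate (a) (`e ∈ τ`; POINTWISE §34.1 (a)): three untyped and eleven typed Kleitman terms. [this work] -/
def atomsA : List (Ty → Ty → Ty → ℤ) :=
  [atomKL anyT (mk 0 0 1) (mk 1 0 0), atomKL anyT (mk 0 0 1) (mk 2 2 0), atomKL anyT (mk 0 2 2) (mk 1 0 0),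
   atomKL (isT (mk 0 0 0)) (mk 0 0 1) (mk 1 0 0), atomKL (isT (mk 0 0 0)) (mk 0 0 1) (mk 2 0 0),
   atomKL (isT (mk 0 0 0)) (mk 0 0 2) (mk 1 0 0), atomKL (isT (mk 0 0 1)) (mk 0 1 2) (mk 1 0 0),
   atomKL (isT (mk 0 0 2)) (mk 0 0 1) (mk 1 0 0), atomKL (isT (mk 0 1 0)) (mk 0 0 1) (mk 1 0 0),
   atomKL (isT (mk 0 1 1)) (mk 0 0 1) (mk 1 0 0), atomKL (isT (mk 0 1 2)) (mk 0 0 1) (mk 1 0 0),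
   atomKL (isT (mk 1 1 0)) (mk 0 0 1) (mk 1 0 0), atomKL (isT (mk 2 1 0)) (mk 0 0 1) (mk 1 0 0),
   atomKL (isT (mk 2 1 2)) (mk 0 0 1) (mk 1 0 0)]

/-- The 12 Kleitman atoms of certificate (b) (`e ∉ τ`; POINTWISE §34.1 (b)); the thirteenth atom is the deletion minor `atomDel`.
[this work] -/
def atomsB : List (Ty → Ty → Ty → ℤ) :=
  [atomKL anyT (mk 0 0 1) (mk 2 2 0), atomKL anyT (mk 0 2 2) (mk 1 0 0),
   atomKL (isT (mk 0 0 0)) (mk 0 0 1) (mk 2 0 0), atomKL (isT (mk 0 0 0)) (mk 0 0 2) (mk 1 0 0),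
   atomKL (isT (mk 0 0 1)) (mk 0 0 1) (mk 1 0 0), atomKL (isT (mk 0 0 2)) (mk 0 0 1) (mk 1 0 0),
   atomKL (isT (mk 0 1 0)) (mk 0 0 1) (mk 1 0 0), atomKL (isT (mk 0 1 1)) (mk 0 1 1) (mk 1 0 0),
   atomKL (isT (mk 0 1 2)) (mk 0 0 1) (mk 1 0 0), atomKL (isT (mk 1 1 0)) (mk 0 0 1) (mk 1 0 0),
   atomKL (isT (mk 2 1 0)) (mk 0 0 1) (mk 1 0 0), atomKL (isT (mk 2 1 2)) (mk 0 0 1) (mk 1 0 0)]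

/-- Residual of certificate (a): `κ₂ − Σ atoms`. [this work] -/
def residA : Ty → Ty → Ty → ℤ := fun ta tb tc => kappa true ta tb tc - (atomsA.map fun f => f ta tb tc).sum

/-- Residual of certificate (b): `κ₁ − Σ atoms − deletion minor`. [this work] -/
def residB : Ty → Ty → Ty → ℤ :=
  fun ta tb tc => kappa false ta tb tc - (atomsB.map fun f => f ta tb tc).sum - atomDel ta tb tc

/-- The ONE-NESTED class `U¹ ⊆ V¹` on types: `t₀ ≥ 1 → t₁ ≥ 1`. [this work] -/
def clsN (t : Ty) : Bool := !decide (1 ≤ t.1) || decide (1 ≤ t.2.1)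

/-- **Certificate (a) is valid** (kernel computation over the `1 771` sorted class triples). [this work] -/
theorem check_residA : check clsN residA = true := by
  decide +kernel

/-- **Certificate (b) is valid** (kernel computation over the `1 771` sorted class triples). [this work] -/
theorem check_residB : check clsN residB = true := by
  decide +kernel

variable [Fintype ι] {𝒰 𝒱 𝒲 : Set (Set ι)} (e : ι) (τ : Set ι)

omit [Fintype ι] in
/-- Under `U¹_e ⊆ V¹_e` every realised type is in the one-nested class. [this work] -/
theorem clsN_typ (h𝒰 : IsUpperSet 𝒰) (h𝒱 : IsUpperSet 𝒱) (hUV : ∀ T : Set ι, insert e T ∈ 𝒰 → insert e T ∈ 𝒱)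
    (w : Set ι) : clsN (typ 𝒰 𝒱 𝒲 e w) = true := by
  simp only [clsN, typ, Bool.or_eq_true, Bool.not_eq_eq_eq_not, Bool.not_true, decide_eq_false_iff_not,
    decide_eq_true_eq, one_le_tyAt_iff h𝒰, one_le_tyAt_iff h𝒱]
  by_cases h : insert e w ∈ 𝒰
  · exact Or.inr (hUV w h)
  · exact Or.inl h

/-- Every atom of certificate (a) has a nonnegative pinned sum. [this work] -/
theorem atomsA_nonneg (h𝒰 : IsUpperSet 𝒰) (h𝒱 : IsUpperSet 𝒱) (h𝒲 : IsUpperSet 𝒲) :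
    ∀ f ∈ atomsA, 0 ≤ tsumP 𝒰 𝒱 𝒲 e τ f := by
  intro f hf
  simp only [atomsA, List.mem_cons, List.not_mem_nil, or_false] at hf
  rcases hf with rfl | rfl | rfl | rfl | rfl | rfl | rfl | rfl | rfl | rfl | rfl | rfl | rfl | rfl <;>
    exact tsumP_atomKL_nonneg 𝒰 𝒱 𝒲 e τ h𝒰 h𝒱 h𝒲 _ _ _

/-- Every atom of certificate (b) has a nonnegative pinned sum. [this work] -/
theorem atomsB_nonneg (h𝒰 : IsUpperSet 𝒰) (h𝒱 : IsUpperSet 𝒱) (h𝒲 : IsUpperSet 𝒲) :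
    ∀ f ∈ atomsB, 0 ≤ tsumP 𝒰 𝒱 𝒲 e τ f := by
  intro f hf
  simp only [atomsB, List.mem_cons, List.not_mem_nil, or_false] at hf
  rcases hf with rfl | rfl | rfl | rfl | rfl | rfl | rfl | rfl | rfl | rfl | rfl | rfl <;>
    exact tsumP_atomKL_nonneg 𝒰 𝒱 𝒲 e τ h𝒰 h𝒱 h𝒲 _ _ _

/-- **THEOREM 1N (a).**  If `e ∈ τ` and the contraction sections at `e` of `𝒰` and `𝒱` are nested (`U¹_e ⊆ V¹_e`, i.e.
`T ∪ e ∈ 𝒰 → T ∪ e ∈ 𝒱`), then `threePartNT τ 𝒰 𝒱 𝒲 ≥ 0` for EVERY up-set `𝒲` — outright, no induction hypothesis.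
(Certificate: `κ₂ ≥` three untyped + eleven typed Kleitman terms, all multipliers `1`; POINTWISE §34.1 (a).) [this work] -/
theorem threePartNT_nonneg_of_oneNested_mem (h𝒰 : IsUpperSet 𝒰) (h𝒱 : IsUpperSet 𝒱) (h𝒲 : IsUpperSet 𝒲)
    (heτ : e ∈ τ) (hUV : ∀ T : Set ι, insert e T ∈ 𝒰 → insert e T ∈ 𝒱) : 0 ≤ threePartNT τ 𝒰 𝒱 𝒲 := by
  rw [threePartNT_eq_tsumP_kappa 𝒰 𝒱 𝒲 e τ h𝒰 h𝒱 h𝒲, decide_eq_true heτ]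
  have hres : 0 ≤ tsumP 𝒰 𝒱 𝒲 e τ residA := tsumP_nonneg_of_check 𝒰 𝒱 𝒲 e τ check_residA (clsN_typ e h𝒰 h𝒱 hUV)
  have hat : 0 ≤ (atomsA.map fun f => tsumP 𝒰 𝒱 𝒲 e τ f).sum :=
    List.sum_nonneg fun x hx => by
      obtain ⟨f, hf, rfl⟩ := List.mem_map.1 hx
      exact atomsA_nonneg e τ h𝒰 h𝒱 h𝒲 f hf
  have hdec : tsumP 𝒰 𝒱 𝒲 e τ (kappa true)
      = tsumP 𝒰 𝒱 𝒲 e τ residA + (atomsA.map fun f => tsumP 𝒰 𝒱 𝒲 e τ f).sum := by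
    rw [← tsumP_listSum, ← tsumP_add]
    exact tsumP_congr 𝒰 𝒱 𝒲 e τ fun a b c => by simp only [residA]; ring
  rw [hdec]
  exact add_nonneg hres hat

/-- **THEOREM 1N (b).**  If `e ∉ τ` and `U¹_e ⊆ V¹_e`, then the `e`-free lift of the DELETION minor is dominated:
`threePartNT τ 𝒰⁰ 𝒱⁰ 𝒲⁰ ≤ 3 · threePartNT τ 𝒰 𝒱 𝒲` with `𝒳⁰ = {T | T ∖ e ∈ 𝒳}` (the factor `3` = the three positions of
the free coordinate `e`, cf. `tri_eq_three_mul_pin`).  (Certificate: `κ₁ ≥` deletion minor + two untyped + ten typed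
Kleitman terms; POINTWISE §34.1 (b).) [this work] -/
theorem threePartNT_deletion_le_three_mul_of_oneNested (h𝒰 : IsUpperSet 𝒰) (h𝒱 : IsUpperSet 𝒱) (h𝒲 : IsUpperSet 𝒲)
    (heτ : e ∉ τ) (hUV : ∀ T : Set ι, insert e T ∈ 𝒰 → insert e T ∈ 𝒱) :
    threePartNT τ {T : Set ι | T \ {e} ∈ 𝒰} {T : Set ι | T \ {e} ∈ 𝒱} {T : Set ι | T \ {e} ∈ 𝒲}
      ≤ 3 * threePartNT τ 𝒰 𝒱 𝒲 := by
  rw [threePartNT_deletion_eq_tsumP, threePartNT_eq_tsumP_kappa 𝒰 𝒱 𝒲 e τ h𝒰 h𝒱 h𝒲, decide_eq_false heτ]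
  have hres : 0 ≤ tsumP 𝒰 𝒱 𝒲 e τ residB := tsumP_nonneg_of_check 𝒰 𝒱 𝒲 e τ check_residB (clsN_typ e h𝒰 h𝒱 hUV)
  have hat : 0 ≤ (atomsB.map fun f => tsumP 𝒰 𝒱 𝒲 e τ f).sum :=
    List.sum_nonneg fun x hx => by
      obtain ⟨f, hf, rfl⟩ := List.mem_map.1 hx
      exact atomsB_nonneg e τ h𝒰 h𝒱 h𝒲 f hf
  have hdec : tsumP 𝒰 𝒱 𝒲 e τ (kappa false)
      = tsumP 𝒰 𝒱 𝒲 e τ residB + (atomsB.map fun f => tsumP 𝒰 𝒱 𝒲 e τ f).sum + tsumP 𝒰 𝒱 𝒲 e τ atomDel := by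
    rw [← tsumP_listSum, ← tsumP_add, ← tsumP_add]
    exact tsumP_congr 𝒰 𝒱 𝒲 e τ fun a b c => by simp only [residB]; ring
  rw [hdec]
  linarith

/-- **ONE-NESTED DELETION STEP** (both profiles): if `U¹_e ⊆ V¹_e` and the `e`-free lift of the deletion minor
`(𝒰⁰, 𝒱⁰, 𝒲⁰)` has nonnegative twisted functional at `τ`, then so has `(𝒰, 𝒱, 𝒲)`. [this work] -/
theorem threePartNT_nonneg_of_oneNested (h𝒰 : IsUpperSet 𝒰) (h𝒱 : IsUpperSet 𝒱) (h𝒲 : IsUpperSet 𝒲)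
    (hUV : ∀ T : Set ι, insert e T ∈ 𝒰 → insert e T ∈ 𝒱)
    (hdel : 0 ≤ threePartNT τ {T : Set ι | T \ {e} ∈ 𝒰} {T : Set ι | T \ {e} ∈ 𝒱} {T : Set ι | T \ {e} ∈ 𝒲}) :
    0 ≤ threePartNT τ 𝒰 𝒱 𝒲 := by
  by_cases heτ : e ∈ τ
  · exact threePartNT_nonneg_of_oneNested_mem e τ h𝒰 h𝒱 h𝒲 heτ hUV
  · have h := threePartNT_deletion_le_three_mul_of_oneNested e τ h𝒰 h𝒱 h𝒲 heτ hUV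
    linarith

/-- The same step with the nested pair in slots 1 and 3 (`U¹_e ⊆ W¹_e`). [this work] -/
theorem threePartNT_nonneg_of_oneNested13 (h𝒰 : IsUpperSet 𝒰) (h𝒱 : IsUpperSet 𝒱) (h𝒲 : IsUpperSet 𝒲)
    (hUW : ∀ T : Set ι, insert e T ∈ 𝒰 → insert e T ∈ 𝒲)
    (hdel : 0 ≤ threePartNT τ {T : Set ι | T \ {e} ∈ 𝒰} {T : Set ι | T \ {e} ∈ 𝒱} {T : Set ι | T \ {e} ∈ 𝒲}) :
    0 ≤ threePartNT τ 𝒰 𝒱 𝒲 := by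
  rw [threePartNT_swap23] at hdel ⊢
  exact threePartNT_nonneg_of_oneNested e τ h𝒰 h𝒲 h𝒱 hUW hdel

/-- The same step with the nested pair in slots 2 and 1 (`V¹_e ⊆ U¹_e`). [this work] -/
theorem threePartNT_nonneg_of_oneNested21 (h𝒰 : IsUpperSet 𝒰) (h𝒱 : IsUpperSet 𝒱) (h𝒲 : IsUpperSet 𝒲)
    (hVU : ∀ T : Set ι, insert e T ∈ 𝒱 → insert e T ∈ 𝒰)
    (hdel : 0 ≤ threePartNT τ {T : Set ι | T \ {e} ∈ 𝒰} {T : Set ι | T \ {e} ∈ 𝒱} {T : Set ι | T \ {e} ∈ 𝒲}) :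
    0 ≤ threePartNT τ 𝒰 𝒱 𝒲 := by
  rw [threePartNT_swap12] at hdel ⊢
  exact threePartNT_nonneg_of_oneNested e τ h𝒱 h𝒰 h𝒲 hVU hdel

end OneNested

end TypedSlice

end Summit.CriticalPhenomena.PercolationContinuityZ3.Theorems.ThreePartition
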